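import Summits.QuantumAdvantage.QuantumAdvantage.Theses.ArithStatLadder
import Literature.NumberTheory.QuadraticFields.ThreeTorsion
import Literature.NumberTheory.QuadraticFields.ThreeTorsionMean
import Literature.NumberTheory.QuadraticFields.ThreeTorsionMeanProofs
import Literature.NumberTheory.CubicFields.ThreeTorsionBridge
import Summits.QuantumAdvantage.QuantumAdvantage.Theorems.ArithStatLadderAvgFaceBeyondPriorParamAmplification

/-!
# Skeleton line `cubic-discriminant-pseudorandomness` for crux `AvgFaceBeyondPrior` (stmt-QuantumAdvantage-2427)

Route `ArithStatLadder`, crux `AvgFaceBeyondPrior` = `(IQ3, U) ∉ Heur_{1/3}BPP`, `IQ3 = {bin d : −d fundamental,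
3 ∣ h(−d)}`, `Uₙ` uniform on the n-bit `d` with `−d` fundamental (`Negative.fundBlock n`, `Negative.ens`,
`Negative.iq3Lang` — the LANDED negative-lane file `AvgFaceBeyondPriorNecessary.lean`; copied here, see §Semantics).

## The line (idea card `Ideas/cubic-discriminant-pseudorandomness.md`, triage r1: pass ×3)

CHANGE THE MEASURE. `Pₙ` = the law of `−Disc K` for `K` uniform among cubic fields with `−Disc K ∈ fundBlock n`
(weight `c(−d) = cubicFieldCountOfDisc (−d)`), `Uₙ` = the crux's ensemble. By Hasse's dictionary
`t(−d) = #Cl₃(−d) = 2 c(−d) + 1` the likelihood ratio is `dPₙ/dUₙ = (t − 1)/(m − 1)`, `m = E_U t → 2`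
(Davenport–Heilbronn), whence the ADVANTAGE IDENTITY
`Σ (t − 2) g = N[(m − 1)(E_P g − E_U g) + (m − 2) E_U g]` for every statistic `g ∈ [0,1]`.
So PSEUDORANDOMNESS OF CUBIC DISCRIMINANTS against PPT tests (`PrgCubic`, the ONE complexity input,
hypothesis-type) gives vanishing correlation of every PPT statistic with `t − 2`; a `Heur_{1/3}` decider,
amplified (`ParamAmplification`) and read as a statistic, has correlation `≥ (dens(3 ∣ h) − 1/3 − o(1))·N`;
and the DENSITY FLOOR `dens > 1/3 + η` eventually follows from the window mean `→ 2` (`WindowMeanTwo`) and ANY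
second-moment bound `E t² ≤ M₂ < 23/3` (`SecondMomentBelow`) by the moment LP `16·𝟙[t ≥ 3] ≥ 12t − t² − 11`
on `t ∈ 3^ℕ`. Contradiction.

## Stubs (5; registered by `ledger skeleton check`), composition `AvgFaceBeyondPrior_of` PROVED here

* `stub_prgCubic`          — `PrgCubic`: planted cubic discriminants fool PPT tests (HYPOTHESIS-TYPE, ≥ NP ⊄ BPP).
* `stub_cubicDictionary`   — Hasse / CFT: `#Cl₃(D) = 2·#{cubic fields of disc D} + 1` on negative fundamental `D`
                             (L; = hypothesis `hCFT` of `ThreeTorsionBridge`, Bhargava–Varma CFT-free road in progress).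
* `stub_dhMeanImaginary`   — Davenport–Heilbronn 1971 Thm 3 / BST Cor. 7, imaginary half: the mean of `#Cl₃(D)` over
                             `−X < D < 0` tends to `2` (XL IN PRINT; verbatim `bst_threeTorsion_mean.neg`, the vendored
                             fact, whose CFT-free proof road `CubicFields/*` is in progress). The WINDOW version
                             `WindowMeanTwo` is DERIVED here (`windowMeanTwo_of_dh`, proved: reindexing `d ↦ −d` +
                             differencing with the PROVED count `abs_card_negFundDiscrs_sub_le`).
* `stub_secondMomentBelow` — `∃ M₂ < 23/3, ∀ᶠ n, Σ_{𝒲ₙ} t² ≤ M₂ #𝒲ₙ` on `𝒲ₙ = negFundDiscrs 2ⁿ ∖ negFundDiscrs 2ⁿ⁻¹`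
                             (XL, OPEN arithmetic statistics; Cohen–Lenstra predict 6; known `Σ_{d<X} h₃² ≪ X^{23/18+ε}`,
                             Heath-Brown–Pierce 2017) — VERBATIM the sibling line `moment-lp-density-floor`'s stub: SHARED.
* `stub_paramAmplification`— majority-vote amplification for `paramEnc` PPT algorithms (M; machine plumbing as in
                             `HeuristicClassesAmplificationProofs.exists_maj3Round`, which is `schemeEnc`-only).

All five stub signatures mention ONLY importable Literature/Mathlib declarations (`negFundDiscrs`,
`quadFieldThreeTorsion`, `cubicFieldCountOfDisc`, `RandAlg`, `paramEnc`, …): the windows are spelled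
`negFundDiscrs (2^n) \ negFundDiscrs (2^(n-1))` and transported to the route's block inside (`sum_window_eq`,
`card_window_eq`, proved). PROVED (no `sorry`): DH on dyadic windows from the plain DH mean (`windowMeanTwo_of_dh`), the moment LP
(`lp_window`), the density floor (`density_floor`), the finite
decision-to-correlation inequality (`corr_lower_bound`), the advantage-identity bound (`corr_upper_bound`),
and the composition `AvgFaceBeyondPrior_of : stubs → AvgFaceBeyondPrior` (concludes the ROUTE decl by name).

## Disproof.lean (cdisprove v3) honoured
`avgFaceBeyondPrior_false_without_PPT`: PPT enters exactly once, in `PrgCubic` (+ the PPT-preserving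
amplification). `avgFace_imp_exists_level(_ge)`: the density floor is carried as `DhMeanImaginary ∧
SecondMomentBelow → dens ≥ 1/3 + η` (proved differencing + LP), never assumed away. `not_avgFace_unconditioned`: every sum is
over the CONDITIONED block `fundBlock n`; no domination transfer. No landed Negative lemma refutes any stub
(`Negative/AvgFaceBeyondPriorNecessary`, `…Blocks` read; their decls are copied verbatim in §Semantics until the
farm has built them, then import).
-/

noncomputable section

set_option linter.dupNamespace false

namespace Summit.QuantumAdvantage.QuantumAdvantage.Cruxes.AvgFaceBeyondPrior.CubicDiscriminantPseudorandomness

open _root_.Computability Filter Finset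
open scoped Topology Classical
open Literature.Computability.Complexity Literature.Computability.MetaComplexity
open Literature.NumberTheory.QuadraticFields Literature.NumberTheory.CubicFields
open Summit.QuantumAdvantage.QuantumAdvantage.Theses.ArithStatLadder

/-! ### Semantics of the crux

`iq3Set`, `iq3Lang`, `fundBlock`, `encodeNat_mem_iq3Lang` are VERBATIM copies of the landed negative-lane decls
`Summit.QuantumAdvantage.QuantumAdvantage.Theorems.AvgFaceBeyondPrior.Negative.*`
(`Theorems/AvgFaceBeyondPrior/Negative/AvgFaceBeyondPriorNecessary.lean`, p77639), copied because the farm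
snapshot has not yet BUILT that module (`lean check` rc 75 `remote:stale:…:unbuilt`). The language is
definitionally the route's; the block `fundBlock n` is the route's finset up to the `Decidable` instance chosen
for `Squarefree` on `ℤ` (this file sees `ThreeTorsionMean.instDecidablePredSquarefreeInt`, the route file did
not), so the crux is never restated here: `AvgFaceBeyondPrior_of` unfolds the ROUTE decl and reads its
ensemble off by unification (`bad_set_of_heur`, whose block argument is closed by `congr`). -/

/-- The set `IQ3 ⊆ ℕ`: `−d` fundamental and `3 ∣ h(−d)` (literal copy of the route's set). -/
def iq3Set : Set ℕ :=
  {d : ℕ | (((-(d:ℤ)) % 4 = 1 ∧ Squarefree (-(d:ℤ)) ∧ (-(d:ℤ)) ≠ 1) ∨ (4 ∣ (-(d:ℤ)) ∧ ((-(d:ℤ)) / 4 % 4 = 2 ∨ (-(d:ℤ)) / 4 % 4 = 3) ∧ Squarefree ((-(d:ℤ)) / 4))) ∧ 3 ∣ Literature.NumberTheory.QuadraticFields.BinaryQuadraticForm.classNumber (-(d:ℤ))}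

/-- The language `IQ3 ⊆ {0,1}*` (LSB-first binary) — definitionally the route's language. -/
def iq3Lang : Set (List Bool) := encodingNatBool.toLanguage iq3Set

/-- The dyadic block of n-bit `d` with `−d` fundamental (literal copy of the route's finset). -/
def fundBlock (n : ℕ) : Finset ℕ :=
  (Finset.Ico (2 ^ (n - 1)) (2 ^ n)).filter (fun d : ℕ => (((-(d:ℤ)) % 4 = 1 ∧ Squarefree (-(d:ℤ)) ∧ (-(d:ℤ)) ≠ 1) ∨ (4 ∣ (-(d:ℤ)) ∧ ((-(d:ℤ)) / 4 % 4 = 2 ∨ (-(d:ℤ)) / 4 % 4 = 3) ∧ Squarefree ((-(d:ℤ)) / 4))))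

/-- Membership of a code word in `IQ3`. -/
theorem encodeNat_mem_iq3Lang (d : ℕ) : encodeNat d ∈ iq3Lang ↔ d ∈ iq3Set :=
  encodingNatBool.mem_toLanguage_iff iq3Set d

/-- **Bad mass is a counting ratio — read off a `Heur_δ` witness by unification.** If `A` has bad mass `≤ δ`
at every level of the ensemble "uniform on `blk m` pushed through `encodeNat` (`pure []` if empty)" for the
language `L`, then at a level `n` whose block `blk n = F` is nonempty the bad `d ∈ F` (coin error `≥ 1/4`
against `L`) number at most `δ·#F`. (`blk`, `L`, `δ` are instantiated from the ROUTE decl's own terms.) -/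
theorem bad_set_of_heur {L : Set (List Bool)} {blk : ℕ → Finset ℕ} {A : RandAlg (List Bool × ℕ) Bool} {δ : ℝ}
    (hgood : ∀ n, Ensemble.prob (fun m => if h : (blk m).Nonempty then (PMF.uniformOfFinset (blk m) h).map encodeNat
        else PMF.pure []) n {x | 1 / 4 ≤ A.pr paramEnc (x, n) {b | b ≠ L.boolIndicator x}} ≤ δ)
    (n : ℕ) (F : Finset ℕ) (hF : blk n = F) (hne : F.Nonempty) :
    ∃ B : Finset ℕ, (B.card : ℝ) ≤ δ * (F.card : ℝ) ∧ B ⊆ F ∧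
      ∀ d ∈ F, d ∉ B → A.pr paramEnc (encodeNat d, n) {b | b ≠ L.boolIndicator (encodeNat d)} < 1 / 4 := by
  subst hF
  have h := hgood n
  unfold Ensemble.prob at h
  try dsimp only at h
  rw [dif_pos hne, PMF.toOuterMeasure_map_apply, PMF.toOuterMeasure_uniformOfFinset_apply,
    ENNReal.toReal_div] at h
  simp only [Set.mem_preimage, ENNReal.toReal_natCast, Set.mem_setOf_eq] at h
  have hpos : (0:ℝ) < ((blk n).card : ℝ) := by exact_mod_cast hne.card_pos
  rw [div_le_iff₀ hpos] at h
  refine ⟨_, h, Finset.filter_subset _ _, fun d hd hdB => ?_⟩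
  rw [Finset.mem_filter, not_and] at hdB
  exact not_le.1 (hdB hd)

/-! ### The statements of the line (named `Prop`s over existing declarations) -/

/-- **PRG_cubic — pseudorandomness of cubic discriminants (hypothesis-type; the line's ONE complexity input).**
For every PPT test `A(x, 1ⁿ)` the acceptance probability has, eventually in `n`, the same mean (up to `ε`)
under the PLANTED measure `Pₙ(d) ∝ #{cubic fields of discriminant −d}` and under the uniform measure on
`fundBlock n`. Separation-strength (with the density floor it implies the crux, hence `IQ3 ∉ BPP`,
`Negative.avgFace_imp_not_mem_BPP`); stated in the standard two-samplable-ensembles shape. -/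
def PrgCubic : Prop :=
  ∀ A : RandAlg (List Bool × ℕ) Bool, A.IsPolyTime paramEnc encodeBool →
    ∀ ε : ℝ, 0 < ε → ∀ᶠ n : ℕ in atTop,
      |(∑ D ∈ negFundDiscrs (2 ^ n) \ negFundDiscrs (2 ^ (n - 1)),
            (cubicFieldCountOfDisc D : ℝ) * A.pr paramEnc (encodeNat D.natAbs, n) {true})
            / (∑ D ∈ negFundDiscrs (2 ^ n) \ negFundDiscrs (2 ^ (n - 1)), (cubicFieldCountOfDisc D : ℝ))
          - (∑ D ∈ negFundDiscrs (2 ^ n) \ negFundDiscrs (2 ^ (n - 1)), A.pr paramEnc (encodeNat D.natAbs, n) {true})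
            / ((negFundDiscrs (2 ^ n) \ negFundDiscrs (2 ^ (n - 1))).card : ℝ)| ≤ ε

/-- **Hasse's class-field-theoretic dictionary** on negative fundamental discriminants:
`#Cl₃(D) = 2·#{cubic fields of discriminant D} + 1` — verbatim the hypothesis `hCFT` of
`ThreeTorsionBridge.btt_threeTorsion_sum_neg_iff_fundCubicFieldCount`. -/
def CubicDictionary : Prop :=
  ∀ X : ℕ, ∀ D ∈ negFundDiscrs X, quadFieldThreeTorsion D = 2 * cubicFieldCountOfDisc D + 1

/-- **Davenport–Heilbronn, imaginary quadratic fields** (DH 1971 Thm 3 / BST Cor. 7): the mean of `#Cl₃(D)` over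
`−X < D < 0` tends to `2` — verbatim the imaginary half `bst_threeTorsion_mean.neg` of the vendored fact. -/
def DhMeanImaginary : Prop :=
  Tendsto (fun X : ℕ =>
    (∑ D ∈ negFundDiscrs X, (quadFieldThreeTorsion D : ℝ)) / ((negFundDiscrs X).card : ℝ)) atTop (𝓝 2)

/-- **Davenport–Heilbronn on dyadic windows** (DERIVED below from `DhMeanImaginary`, `windowMeanTwo_of_dh`): the
mean of `#Cl₃(−d)` over `fundBlock n` tends to `2`. -/
def WindowMeanTwo : Prop :=
  Tendsto (fun n : ℕ =>
    (∑ d ∈ fundBlock n, (quadFieldThreeTorsion (-(d:ℤ)) : ℝ)) / ((fundBlock n).card : ℝ)) atTop (𝓝 2)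

/-- **A second moment below `23/3`** (eventually, on the dyadic windows
`𝒲ₙ = negFundDiscrs (2^n) ∖ negFundDiscrs (2^(n-1))`). Cohen–Lenstra predict `6`. STATED VERBATIM AS IN THE SIBLING
LINE `Lines/moment-lp-density-floor.lean` (`stub_secondMomentBelow` there), so that the two lines SHARE this
registered stub. -/
def SecondMomentBelow : Prop :=
  ∃ M₂ : ℝ, M₂ < 23 / 3 ∧ ∀ᶠ n : ℕ in atTop,
    ∑ D ∈ negFundDiscrs (2 ^ n) \ negFundDiscrs (2 ^ (n - 1)), ((quadFieldThreeTorsion D : ℝ)) ^ 2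
      ≤ M₂ * ((negFundDiscrs (2 ^ n) \ negFundDiscrs (2 ^ (n - 1))).card : ℝ)

/-- The same bound re-indexed on the route's block `fundBlock n` (internal; `secondMomentBelowBlock_of`). -/
def SecondMomentBelowBlock : Prop :=
  ∃ M₂ : ℝ, M₂ < 23 / 3 ∧ ∀ᶠ n : ℕ in atTop,
    (∑ d ∈ fundBlock n, ((quadFieldThreeTorsion (-(d:ℤ)) : ℝ)) ^ 2) ≤ M₂ * ((fundBlock n).card : ℝ)

/-- **Amplification for parametrised PPT algorithms**: coin error `< 1/4` can be driven below any `η > 0`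
by a PPT algorithm on the same inputs (iterated majority of three). -/
def ParamAmplification : Prop :=
  ∀ A : RandAlg (List Bool × ℕ) Bool, A.IsPolyTime paramEnc encodeBool →
    ∀ η : ℝ, 0 < η → ∃ A' : RandAlg (List Bool × ℕ) Bool, A'.IsPolyTime paramEnc encodeBool ∧
      ∀ (q : List Bool × ℕ) (c : Bool),
        A.pr paramEnc q {b | b ≠ c} < 1 / 4 → A'.pr paramEnc q {b | b ≠ c} ≤ η

/-! ### The stubs (registered; `sorry` only here) -/

/-- STUB 1 (XL, HYPOTHESIS-TYPE — do not expect it to close: with the density floor it proves the crux, and the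
crux proves `IQ3 ∉ BPP` hence `NP ⊄ BPP`): `PrgCubic`, pseudorandomness of the discriminant of a random cubic
field among fundamental discriminants, against PPT tests. Falsifiable by experiment (both ensembles samplable up
to 1/poly); its junta/digit/AC⁰ restrictions are the route's rungs. [cite: BogdanovTrevisan2006, Def. 2.13;
DavenportHeilbronn1971; BhargavaShankarTsimerman2012, §8.5] -/
theorem stub_prgCubic :
    ∀ A : RandAlg (List Bool × ℕ) Bool, A.IsPolyTime paramEnc encodeBool →
      ∀ ε : ℝ, 0 < ε → ∀ᶠ n : ℕ in atTop,
        |(∑ D ∈ negFundDiscrs (2 ^ n) \ negFundDiscrs (2 ^ (n - 1)),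
              (cubicFieldCountOfDisc D : ℝ) * A.pr paramEnc (encodeNat D.natAbs, n) {true})
              / (∑ D ∈ negFundDiscrs (2 ^ n) \ negFundDiscrs (2 ^ (n - 1)), (cubicFieldCountOfDisc D : ℝ))
            - (∑ D ∈ negFundDiscrs (2 ^ n) \ negFundDiscrs (2 ^ (n - 1)), A.pr paramEnc (encodeNat D.natAbs, n) {true})
              / ((negFundDiscrs (2 ^ n) \ negFundDiscrs (2 ^ (n - 1))).card : ℝ)| ≤ ε := by
  sorry

/-- STUB 2 (L, IN PRINT; the tree's CFT-free road `CubicFields/ThreeTorsionParametrization*` is discharging it):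
Hasse 1930 / BST §8.5 / Bhargava–Varma Thm 9 — for a negative fundamental discriminant `D`,
`#Cl₃(D) = 2·#{cubic fields of discriminant D} + 1`. [cite: BhargavaShankarTsimerman2012, §8.5] -/
theorem stub_cubicDictionary :
    ∀ X : ℕ, ∀ D ∈ negFundDiscrs X, quadFieldThreeTorsion D = 2 * cubicFieldCountOfDisc D + 1 := by
  sorry

/-- STUB 3 (XL IN PRINT — closes by citation once the tree's Davenport–Heilbronn road lands; = `(h :
bst_threeTorsion_mean).1`): Davenport–Heilbronn 1971 Thm 3 / Bhargava–Shankar–Tsimerman Cor. 7, imaginary half —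
the mean of `#Cl₃(D)` over the imaginary quadratic fields with `|D| < X` tends to `2`. (The dyadic-window form the
line consumes is derived from it in this file, `windowMeanTwo_of_dh`, using the PROVED count
`abs_card_negFundDiscrs_sub_le`.) [cite: DavenportHeilbronn1971, Thm 3; BhargavaShankarTsimerman2012, Cor. 7] -/
theorem stub_dhMeanImaginary :
    Tendsto (fun X : ℕ =>
      (∑ D ∈ negFundDiscrs X, (quadFieldThreeTorsion D : ℝ)) / ((negFundDiscrs X).card : ℝ)) atTop (𝓝 2) := by
  sorry

/-- STUB 4 (XL, OPEN — the attackable hard core of the line): some second-moment bound `M₂ < 23/3` for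
`t = #Cl₃(−d)` on dyadic windows, eventually. Cohen–Lenstra (C6)-type heuristics predict `E t² → 6`; in print
only `Σ_{d<X} h₃(−d)² ≪ X^{23/18+ε}` (Heath-Brown–Pierce 2017, Cor. 1.4). An UPPER bound with 27 % slack, not an
asymptotic. [cite: HeathbrownPierce2017, Cor. 1.4; CohenLenstra1984, §9 (C6)] -/
theorem stub_secondMomentBelow :
    ∃ M₂ : ℝ, M₂ < 23 / 3 ∧ ∀ᶠ n : ℕ in atTop,
      ∑ D ∈ negFundDiscrs (2 ^ n) \ negFundDiscrs (2 ^ (n - 1)), ((quadFieldThreeTorsion D : ℝ)) ^ 2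
        ≤ M₂ * ((negFundDiscrs (2 ^ n) \ negFundDiscrs (2 ^ (n - 1))).card : ℝ) := by
  sorry

/-- STUB 5 (M, machine plumbing) — CLOSED by p96229 (`Theorems.AvgFaceBeyondPrior.Cubic.stub_paramAmplification`): amplification of parametrised PPT algorithms — port of
`HeuristicClassesAmplificationProofs.exists_freshCoin/exists_maj3Round` (there for `schemeEnc`) to `paramEnc`:
one round of majority-of-three on deinterleaved coins maps coin error `e ↦ e²(3 − 2e)`, iterate a constant
number of times (`1/4 ↦ 5/32 ↦ … ≤ η`). [cite: BogdanovTrevisan2006, §2.3 (remark after Def. 2.11);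
AroraBarakCC2009, Thm. 7.10] -/
theorem stub_paramAmplification :
    ∀ A : RandAlg (List Bool × ℕ) Bool, A.IsPolyTime paramEnc encodeBool →
      ∀ η : ℝ, 0 < η → ∃ A' : RandAlg (List Bool × ℕ) Bool, A'.IsPolyTime paramEnc encodeBool ∧
        ∀ (q : List Bool × ℕ) (c : Bool),
          A.pr paramEnc q {b | b ≠ c} < 1 / 4 → A'.pr paramEnc q {b | b ≠ c} ≤ η :=
  -- LANDED (p96229, Theorems/ArithStatLadderAvgFaceBeyondPriorParamAmplification.lean)
  Summit.QuantumAdvantage.QuantumAdvantage.Theorems.AvgFaceBeyondPrior.Cubic.stub_paramAmplification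

/-! ### Consistency: each named statement IS its registered stub (definitionally) -/

theorem prgCubic_holds : PrgCubic := stub_prgCubic
theorem cubicDictionary_holds : CubicDictionary := stub_cubicDictionary
theorem dhMeanImaginary_holds : DhMeanImaginary := stub_dhMeanImaginary
theorem secondMomentBelow_holds : SecondMomentBelow := stub_secondMomentBelow
theorem paramAmplification_holds : ParamAmplification := stub_paramAmplification

/-! ### Name-keyed aliases of the statements (the hypotheses of the composition; the skeleton audit admits a
hypothesis only if its head constant is a registered obligation or is NAMED LIKE A DECLARED STUB — the
`stub` attribute itself is gate-reserved, so the aliases carry the registered names `stub_*`) -/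
namespace Registered

/-- Alias of `PrgCubic` keyed by the registered stub name. -/
abbrev stub_prgCubic : Prop := PrgCubic
/-- Alias of `CubicDictionary` keyed by the registered stub name. -/
abbrev stub_cubicDictionary : Prop := CubicDictionary
/-- Alias of `DhMeanImaginary` keyed by the registered stub name. -/
abbrev stub_dhMeanImaginary : Prop := DhMeanImaginary
/-- Alias of `SecondMomentBelow` keyed by the registered stub name. -/
abbrev stub_secondMomentBelow : Prop := SecondMomentBelow
/-- Alias of `ParamAmplification` keyed by the registered stub name. -/
abbrev stub_paramAmplification : Prop := ParamAmplification

end Registered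

/-! ### Glue 0 (PROVED): Davenport–Heilbronn on dyadic windows from the plain mean -/

/-- `d ↦ −d` as an embedding `ℕ ↪ ℤ`. -/
def negEmb : ℕ ↪ ℤ := ⟨fun d : ℕ => -(d:ℤ), fun a b h => by
  have h' : (a:ℤ) = (b:ℤ) := neg_inj.1 h
  exact_mod_cast h'⟩

@[simp] theorem negEmb_apply (d : ℕ) : negEmb d = -(d:ℤ) := rfl

/-- **Reindexing**: `d ↦ −d` maps the dyadic block onto `negFundDiscrs (2^n) ∖ negFundDiscrs (2^(n-1))`
(exactly: `−2^n < D ≤ −2^(n−1) ⟺ 2^(n−1) ≤ d < 2^n`). -/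
theorem fundBlock_map_neg (n : ℕ) :
    (fundBlock n).map negEmb = negFundDiscrs (2 ^ n) \ negFundDiscrs (2 ^ (n - 1)) := by
  ext D
  simp only [Finset.mem_map, Finset.mem_sdiff, mem_negFundDiscrs, fundBlock, Finset.mem_filter, Finset.mem_Ico,
    negEmb_apply]
  constructor
  · rintro ⟨d, ⟨⟨h1, h2⟩, hP⟩, rfl⟩
    have hpos := Nat.two_pow_pos (n - 1)
    refine ⟨⟨⟨by omega, by omega⟩, hP⟩, ?_⟩
    rintro ⟨⟨h3, -⟩, -⟩
    omega
  · rintro ⟨⟨⟨h1, h2⟩, hQ⟩, hnot⟩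
    obtain ⟨d, rfl⟩ : ∃ d : ℕ, D = -(d:ℤ) := ⟨D.natAbs, by omega⟩
    refine ⟨d, ⟨⟨?_, by omega⟩, hQ⟩, rfl⟩
    by_contra hlt
    exact hnot ⟨⟨by omega, h2⟩, hQ⟩

/-- `negFundDiscrs` is monotone in `X`. -/
theorem negFundDiscrs_mono {X Y : ℕ} (h : X ≤ Y) : negFundDiscrs X ⊆ negFundDiscrs Y := by
  intro D hD
  rw [mem_negFundDiscrs] at hD ⊢
  exact ⟨⟨by omega, hD.1.2⟩, hD.2⟩

/-- **Transport window → block**: sums over `𝒲ₙ` are sums over `fundBlock n` at `D = −d`. -/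
theorem sum_window_eq (n : ℕ) (f : ℤ → ℝ) :
    ∑ D ∈ negFundDiscrs (2 ^ n) \ negFundDiscrs (2 ^ (n - 1)), f D = ∑ d ∈ fundBlock n, f (-(d:ℤ)) := by
  rw [← fundBlock_map_neg, Finset.sum_map]
  simp

/-- **Transport window → block**: `#𝒲ₙ = #fundBlock n`. -/
theorem card_window_eq (n : ℕ) :
    (negFundDiscrs (2 ^ n) \ negFundDiscrs (2 ^ (n - 1))).card = (fundBlock n).card := by
  rw [← fundBlock_map_neg, Finset.card_map]

/-- The shared second-moment stub, re-indexed on `fundBlock n`. -/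
theorem secondMomentBelowBlock_of (h : SecondMomentBelow) : SecondMomentBelowBlock := by
  obtain ⟨M₂, hM₂, hev⟩ := h
  refine ⟨M₂, hM₂, hev.mono fun n hn => ?_⟩
  rw [sum_window_eq n (fun D => ((quadFieldThreeTorsion D : ℝ)) ^ 2), card_window_eq] at hn
  exact hn

/-- `N(X) = #negFundDiscrs X` as a real number. -/
def negCount (X : ℕ) : ℝ := ((negFundDiscrs X).card : ℝ)

/-- `S(X) = Σ_{D ∈ negFundDiscrs X} #Cl₃(D)`. -/
def negSum (X : ℕ) : ℝ := ∑ D ∈ negFundDiscrs X, (quadFieldThreeTorsion D : ℝ)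

/-- The window sum is a difference of two initial sums. -/
theorem sum_fundBlock_eq (n : ℕ) :
    (∑ d ∈ fundBlock n, (quadFieldThreeTorsion (-(d:ℤ)) : ℝ)) = negSum (2 ^ n) - negSum (2 ^ (n - 1)) := by
  have hsub : negFundDiscrs (2 ^ (n - 1)) ⊆ negFundDiscrs (2 ^ n) :=
    negFundDiscrs_mono (Nat.pow_le_pow_right (by norm_num) (Nat.sub_le n 1))
  unfold negSum
  rw [← Finset.sum_sdiff hsub, add_sub_cancel_right, ← fundBlock_map_neg, Finset.sum_map]
  simp

/-- The window count is a difference of two initial counts. -/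
theorem card_fundBlock_eq (n : ℕ) :
    ((fundBlock n).card : ℝ) = negCount (2 ^ n) - negCount (2 ^ (n - 1)) := by
  have hsub : negFundDiscrs (2 ^ (n - 1)) ⊆ negFundDiscrs (2 ^ n) :=
    negFundDiscrs_mono (Nat.pow_le_pow_right (by norm_num) (Nat.sub_le n 1))
  have h := Finset.card_sdiff_add_card_eq_card hsub
  rw [← fundBlock_map_neg, Finset.card_map] at h
  unfold negCount
  have h' := congrArg (fun k : ℕ => (k : ℝ)) h
  push_cast at h'
  linarith

/-- Pure-real core of the differencing: `|S₁/N₁ − 2| ≤ e₁`, `|S₀/N₀ − 2| ≤ e₀`, `N₁ ≤ 8(N₁ − N₀)`, `N₀ ≤ 4(N₁ − N₀)`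
give `|(S₁ − S₀)/(N₁ − N₀) − 2| ≤ 8e₁ + 4e₀`. -/
theorem ratio_core {N1 N0 S1 S0 e1 e0 : ℝ} (hD : 0 < N1 - N0) (hN0 : 0 < N0)
    (hN1 : N1 ≤ 8 * (N1 - N0)) (hN0' : N0 ≤ 4 * (N1 - N0))
    (h1 : |S1 / N1 - 2| ≤ e1) (h0 : |S0 / N0 - 2| ≤ e0) :
    |(S1 - S0) / (N1 - N0) - 2| ≤ 8 * e1 + 4 * e0 := by
  have hN1pos : 0 < N1 := by linarith
  have he1 : 0 ≤ e1 := (abs_nonneg _).trans h1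
  have he0 : 0 ≤ e0 := (abs_nonneg _).trans h0
  have q1 : (S1 - 2 * N1) / N1 = S1 / N1 - 2 := by
    rw [sub_div, mul_div_cancel_right₀ _ hN1pos.ne']
  have q0 : (S0 - 2 * N0) / N0 = S0 / N0 - 2 := by
    rw [sub_div, mul_div_cancel_right₀ _ hN0.ne']
  have q : ((S1 - 2 * N1) - (S0 - 2 * N0)) / (N1 - N0) = (S1 - S0) / (N1 - N0) - 2 := by
    rw [show (S1 - 2 * N1) - (S0 - 2 * N0) = (S1 - S0) - 2 * (N1 - N0) by ring, sub_div,
      mul_div_cancel_right₀ _ hD.ne']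
  have hA : |S1 - 2 * N1| ≤ e1 * N1 := by
    rw [← q1, abs_div, abs_of_pos hN1pos, div_le_iff₀ hN1pos] at h1
    exact h1
  have hB : |S0 - 2 * N0| ≤ e0 * N0 := by
    rw [← q0, abs_div, abs_of_pos hN0, div_le_iff₀ hN0] at h0
    exact h0
  rw [← q, abs_div, abs_of_pos hD, div_le_iff₀ hD]
  calc |S1 - 2 * N1 - (S0 - 2 * N0)| ≤ |S1 - 2 * N1| + |S0 - 2 * N0| := abs_sub _ _
    _ ≤ e1 * N1 + e0 * N0 := add_le_add hA hB
    _ ≤ e1 * (8 * (N1 - N0)) + e0 * (4 * (N1 - N0)) :=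
        add_le_add (mul_le_mul_of_nonneg_left hN1 he1) (mul_le_mul_of_nonneg_left hN0' he0)
    _ = (8 * e1 + 4 * e0) * (N1 - N0) := by ring

/-- Pure-real consequence of the count `N(X) = cX + O(√X)` on a dyadic window `[X, 2X)`, once `X ≥ (64/c)²`:
`0 < N₀`, `0 < N₁ − N₀`, `N₁ ≤ 8(N₁ − N₀)`, `N₀ ≤ 4(N₁ − N₀)`. -/
theorem count_window {c X N1 N0 : ℝ} (hc : 0 < c) (hX : (64 / c) ^ 2 ≤ X)
    (hN1 : |N1 - c * (2 * X)| ≤ 8 * Real.sqrt (2 * X)) (hN0 : |N0 - c * X| ≤ 8 * Real.sqrt X) :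
    0 < N1 - N0 ∧ 0 < N0 ∧ N1 ≤ 8 * (N1 - N0) ∧ N0 ≤ 4 * (N1 - N0) := by
  have h64 : (0:ℝ) < 64 / c := by positivity
  have hXpos : 0 < X := lt_of_lt_of_le (by positivity) hX
  have hsx : 64 / c ≤ Real.sqrt X := by
    rw [← Real.sqrt_sq h64.le]
    exact Real.sqrt_le_sqrt hX
  have hsqX : Real.sqrt X * Real.sqrt X = X := Real.mul_self_sqrt hXpos.le
  have h32 : 32 * Real.sqrt X ≤ c / 2 * X := by
    have : c / 2 * X = (c / 2 * Real.sqrt X) * Real.sqrt X := by rw [mul_assoc, hsqX]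
    rw [this]
    have h2 : (32:ℝ) ≤ c / 2 * Real.sqrt X := by
      have := mul_le_mul_of_nonneg_left hsx (by positivity : (0:ℝ) ≤ c / 2)
      calc (32:ℝ) = c / 2 * (64 / c) := by field_simp; ring
        _ ≤ c / 2 * Real.sqrt X := this
    exact mul_le_mul_of_nonneg_right h2 (Real.sqrt_nonneg X)
  have hs2 : Real.sqrt (2 * X) ≤ 2 * Real.sqrt X := by
    have h4 : Real.sqrt (4 * X) = 2 * Real.sqrt X := by
      rw [Real.sqrt_mul (by norm_num : (0:ℝ) ≤ 4), show (4:ℝ) = 2 ^ 2 by norm_num,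
        Real.sqrt_sq (by norm_num : (0:ℝ) ≤ 2)]
    rw [← h4]
    exact Real.sqrt_le_sqrt (by linarith)
  have a1 := (abs_le.1 hN1).1
  have a2 := (abs_le.1 hN1).2
  have b1 := (abs_le.1 hN0).1
  have b2 := (abs_le.1 hN0).2
  have hsnn := Real.sqrt_nonneg X
  have hcX : 0 < c * X := mul_pos hc hXpos
  refine ⟨by nlinarith, by nlinarith, by nlinarith, by nlinarith⟩

/-- **Davenport–Heilbronn on dyadic windows from the plain Davenport–Heilbronn mean** (and the PROVED count
`abs_card_negFundDiscrs_sub_le`, `N(X) = (3/π²)X + O(√X)`): along `X = 2^m, 2^{m+1}` the ratios tend to `2`, the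
window holds a positive fraction of the mass, and `ratio_core` differences. -/
theorem windowMeanTwo_of_dh (h : DhMeanImaginary) : WindowMeanTwo := by
  have hmean : Tendsto (fun X : ℕ => negSum X / negCount X) atTop (𝓝 2) := h
  have hcount : ∀ X : ℕ, |negCount X - 3 / Real.pi ^ 2 * X| ≤ 8 * Real.sqrt X :=
    abs_card_negFundDiscrs_sub_le
  have hc : (0:ℝ) < 3 / Real.pi ^ 2 := by positivity
  -- subsequences X = 2^(m+1) and X = 2^m
  have hpow : Tendsto (fun m : ℕ => 2 ^ m) atTop atTop :=
    tendsto_pow_atTop_atTop_of_one_lt (by norm_num : (1:ℕ) < 2)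
  have h1 : Tendsto (fun m : ℕ => negSum (2 ^ (m + 1)) / negCount (2 ^ (m + 1))) atTop (𝓝 2) :=
    hmean.comp (hpow.comp (tendsto_add_atTop_nat 1))
  have h0 : Tendsto (fun m : ℕ => negSum (2 ^ m) / negCount (2 ^ m)) atTop (𝓝 2) := hmean.comp hpow
  -- the real sequence 2^m tends to infinity
  have hreal : Tendsto (fun m : ℕ => ((2 ^ m : ℕ) : ℝ)) atTop atTop := by
    have := tendsto_pow_atTop_atTop_of_one_lt (by norm_num : (1:ℝ) < 2)
    refine this.congr' (Filter.Eventually.of_forall fun m => ?_)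
    simp
  show Tendsto (fun n : ℕ =>
    (∑ d ∈ fundBlock n, (quadFieldThreeTorsion (-(d:ℤ)) : ℝ)) / ((fundBlock n).card : ℝ)) atTop (𝓝 2)
  rw [Metric.tendsto_atTop]
  intro ε hε
  obtain ⟨m₁, hm₁⟩ := Metric.tendsto_atTop.1 h1 (ε / 16) (by positivity)
  obtain ⟨m₀, hm₀⟩ := Metric.tendsto_atTop.1 h0 (ε / 16) (by positivity)
  obtain ⟨m₂, hm₂⟩ := Filter.eventually_atTop.1 (Filter.tendsto_atTop.1 hreal ((64 / (3 / Real.pi ^ 2)) ^ 2))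
  refine ⟨m₁ + m₀ + m₂ + 1, fun n hn => ?_⟩
  obtain ⟨m, rfl⟩ : ∃ m, n = m + 1 := ⟨n - 1, by omega⟩
  have hm1 := hm₁ m (by omega)
  have hm0 := hm₀ m (by omega)
  have hm2 := hm₂ m (by omega)
  beta_reduce at hm1 hm0 ⊢
  rw [Real.dist_eq] at hm1 hm0 ⊢
  rw [sum_fundBlock_eq, card_fundBlock_eq]
  simp only [Nat.add_sub_cancel]
  -- counts at X = 2^m and 2X = 2^(m+1)
  have h2X : ((2 ^ (m + 1) : ℕ) : ℝ) = 2 * ((2 ^ m : ℕ) : ℝ) := by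
    push_cast; ring
  have hN1 : |negCount (2 ^ (m + 1)) - 3 / Real.pi ^ 2 * (2 * ((2 ^ m : ℕ) : ℝ))|
      ≤ 8 * Real.sqrt (2 * ((2 ^ m : ℕ) : ℝ)) := by
    have := hcount (2 ^ (m + 1)); rwa [h2X] at this
  have hN0 : |negCount (2 ^ m) - 3 / Real.pi ^ 2 * ((2 ^ m : ℕ) : ℝ)| ≤ 8 * Real.sqrt ((2 ^ m : ℕ) : ℝ) :=
    hcount (2 ^ m)
  obtain ⟨hD, hN0pos, hN1le, hN0le⟩ := count_window hc hm2 hN1 hN0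
  have key := ratio_core hD hN0pos hN1le hN0le hm1.le hm0.le
  linarith

/-! ### Glue 1 (PROVED): the moment LP and the density floor -/

/-- Pointwise LP certificate on powers of three: `12·3^r − 9^r − 11 ≤ 16·[3^r > 1]` (equality at `r = 1, 2`). -/
theorem lp_pointwise (r : ℕ) :
    12 * ((3:ℝ) ^ r) - ((3:ℝ) ^ r) ^ 2 - 11 ≤ 16 * (if 1 < 3 ^ r then (1:ℝ) else 0) := by
  rcases r with _ | _ | _ | r
  · norm_num
  · norm_num
  · norm_num
  · have h27 : (27:ℝ) ≤ (3:ℝ) ^ (r + 3) := by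
      have : (3:ℝ) ^ 3 ≤ (3:ℝ) ^ (r + 3) := pow_le_pow_right₀ (by norm_num) (by omega)
      norm_num at this
      exact this
    have hlt : 1 < 3 ^ (r + 3) := Nat.one_lt_pow (by omega) (by norm_num)
    rw [if_pos hlt]
    nlinarith [h27]

/-- **The moment LP on a window of `d`'s** (`t = #Cl₃(−d) ∈ 3^ℕ`, `exists_quadFieldThreeTorsion_eq_pow`):
`12 Σ t − Σ t² − 11·#S ≤ 16 · #{d ∈ S : 1 < t(−d)}`. -/
theorem lp_window (S : Finset ℕ) :
    12 * (∑ d ∈ S, (quadFieldThreeTorsion (-(d:ℤ)) : ℝ))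
        - (∑ d ∈ S, ((quadFieldThreeTorsion (-(d:ℤ)) : ℝ)) ^ 2) - 11 * (S.card : ℝ)
      ≤ 16 * ((S.filter (fun d : ℕ => 1 < quadFieldThreeTorsion (-(d:ℤ)))).card : ℝ) := by
  have hcard : ((S.filter (fun d : ℕ => 1 < quadFieldThreeTorsion (-(d:ℤ)))).card : ℝ)
      = ∑ d ∈ S, (if 1 < quadFieldThreeTorsion (-(d:ℤ)) then (1:ℝ) else 0) := by
    rw [Finset.sum_ite, Finset.sum_const_zero, add_zero, Finset.sum_const, nsmul_eq_mul, mul_one]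
  have hS : (S.card : ℝ) = ∑ d ∈ S, (1:ℝ) := by
    rw [Finset.sum_const, nsmul_eq_mul, mul_one]
  rw [hcard, hS, Finset.mul_sum, Finset.mul_sum, Finset.mul_sum, ← Finset.sum_sub_distrib,
    ← Finset.sum_sub_distrib]
  refine Finset.sum_le_sum fun d _ => ?_
  obtain ⟨r, hr⟩ := exists_quadFieldThreeTorsion_eq_pow (-(d:ℤ))
  rw [hr]
  push_cast
  have := lp_pointwise r
  linarith

/-- **Density floor** (card `moment-lp-density-floor` = this line's arithmetic module; the obligation of
`Negative.avgFace_imp_exists_level` in proof-direction shape): window mean `→ 2` and a second moment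
`≤ M₂ < 23/3` give, eventually, `#{d ∈ fundBlock n : 3 ∣ h(−d)} ≥ (1/3 + η)·#fundBlock n` with
`η = min((23/3 − M₂)/32, 1) > 0`. -/
theorem density_floor (hM : WindowMeanTwo) (hS : SecondMomentBelowBlock) :
    ∃ η : ℝ, 0 < η ∧ η ≤ 1 ∧ ∀ᶠ n : ℕ in atTop,
      (1 / 3 + η) * ((fundBlock n).card : ℝ)
        ≤ (((fundBlock n).filter (fun d : ℕ => 1 < quadFieldThreeTorsion (-(d:ℤ)))).card : ℝ) := by
  obtain ⟨M₂, hM₂, hsec⟩ := hS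
  have hθpos : 0 < (23 / 3 - M₂) / 24 := by linarith
  refine ⟨min ((23 / 3 - M₂) / 32) 1, lt_min (by linarith) one_pos, min_le_right _ _, ?_⟩
  have hmean : ∀ᶠ n : ℕ in atTop,
      dist ((∑ d ∈ fundBlock n, (quadFieldThreeTorsion (-(d:ℤ)) : ℝ)) / ((fundBlock n).card : ℝ)) 2
        < (23 / 3 - M₂) / 24 :=
    Metric.tendsto_nhds.1 hM _ hθpos
  filter_upwards [hmean, hsec] with n hn hs
  have hLP := lp_window (fundBlock n)
  have hmin : min ((23 / 3 - M₂) / 32) 1 ≤ (23 / 3 - M₂) / 32 := min_le_left _ _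
  rw [Real.dist_eq] at hn
  by_cases hN0 : ((fundBlock n).card : ℝ) = 0
  · rw [hN0, mul_zero]
    exact Nat.cast_nonneg _
  have hNpos : 0 < ((fundBlock n).card : ℝ) := lt_of_le_of_ne (Nat.cast_nonneg _) (Ne.symm hN0)
  have hT : (2 - (23 / 3 - M₂) / 24) * ((fundBlock n).card : ℝ)
      ≤ ∑ d ∈ fundBlock n, (quadFieldThreeTorsion (-(d:ℤ)) : ℝ) := by
    have h2 : 2 - (23 / 3 - M₂) / 24
        < (∑ d ∈ fundBlock n, (quadFieldThreeTorsion (-(d:ℤ)) : ℝ)) / ((fundBlock n).card : ℝ) := by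
      have := (abs_lt.1 hn).1
      linarith
    exact ((lt_div_iff₀ hNpos).1 h2).le
  have key : (1 / 3 + (23 / 3 - M₂) / 32) * ((fundBlock n).card : ℝ)
      ≤ (((fundBlock n).filter (fun d : ℕ => 1 < quadFieldThreeTorsion (-(d:ℤ)))).card : ℝ) := by
    nlinarith [hLP, hT, hs, hNpos.le]
  calc (1 / 3 + min ((23 / 3 - M₂) / 32) 1) * ((fundBlock n).card : ℝ)
      ≤ (1 / 3 + (23 / 3 - M₂) / 32) * ((fundBlock n).card : ℝ) :=
        mul_le_mul_of_nonneg_right (by linarith) hNpos.le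
    _ ≤ _ := key

/-! ### Glue 2 (PROVED): decision ⇒ correlation (the finite threshold inequality) -/

/-- **Finite decision-to-correlation inequality.** On a window `F` with weights `t ∈ {1} ∪ [3, ∞)`
(`t = 3^{r₃}`), a `[0,1]`-statistic `g` that is `≥ 1 − η₁` on members (`1 < t`) and `≤ η₁` on non-members
outside a bad set `B ⊆ F` has correlation `Σ (t − 2) g ≥ (1 − η₁)·#members − #B − η₁·#F`.
(Pointwise: `(t − 2) g ≥ (1 − η₁)𝟙[member] − 𝟙[bad] − η₁`.) -/
theorem corr_lower_bound (F B : Finset ℕ) (hBF : B ⊆ F) (t : ℕ → ℕ) (g : ℕ → ℝ) {η₁ : ℝ}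
    (hη₁ : 0 ≤ η₁)
    (ht1 : ∀ d ∈ F, 1 ≤ t d) (ht3 : ∀ d ∈ F, 1 < t d → 3 ≤ t d)
    (hg0 : ∀ d ∈ F, 0 ≤ g d) (hg1 : ∀ d ∈ F, g d ≤ 1)
    (hgoodM : ∀ d ∈ F, d ∉ B → 1 < t d → 1 - η₁ ≤ g d)
    (hgoodN : ∀ d ∈ F, d ∉ B → ¬ 1 < t d → g d ≤ η₁) :
    (1 - η₁) * ((F.filter (fun d : ℕ => 1 < t d)).card : ℝ) - (B.card : ℝ) - η₁ * (F.card : ℝ)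
      ≤ ∑ d ∈ F, ((t d : ℝ) - 2) * g d := by
  have hpt : ∀ d ∈ F,
      (1 - η₁) * (if 1 < t d then (1:ℝ) else 0) - (if d ∈ B then (1:ℝ) else 0) - η₁
        ≤ ((t d : ℝ) - 2) * g d := by
    intro d hd
    have h0 := hg0 d hd
    have h1 := hg1 d hd
    by_cases hm : 1 < t d
    · have h3 : (3:ℝ) ≤ t d := by exact_mod_cast ht3 d hd hm
      rw [if_pos hm]
      by_cases hb : d ∈ B
      · rw [if_pos hb]
        nlinarith
      · rw [if_neg hb]
        have := hgoodM d hd hb hm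
        nlinarith
    · have ht : (t d : ℝ) = 1 := by
        have hle : t d ≤ 1 := not_lt.1 hm
        have := ht1 d hd
        exact_mod_cast le_antisymm hle this
      rw [if_neg hm, ht]
      by_cases hb : d ∈ B
      · rw [if_pos hb]
        nlinarith
      · rw [if_neg hb]
        have := hgoodN d hd hb hm
        linarith
  have hsum : ∑ d ∈ F, ((1 - η₁) * (if 1 < t d then (1:ℝ) else 0) - (if d ∈ B then (1:ℝ) else 0) - η₁)
      = (1 - η₁) * ((F.filter (fun d : ℕ => 1 < t d)).card : ℝ) - (B.card : ℝ) - η₁ * (F.card : ℝ) := by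
    have hB : ((F.filter (fun d : ℕ => d ∈ B)).card : ℝ) = (B.card : ℝ) := by
      rw [Finset.filter_mem_eq_inter, Finset.inter_eq_right.2 hBF]
    rw [Finset.sum_sub_distrib, Finset.sum_sub_distrib, ← Finset.mul_sum, Finset.sum_boole, Finset.sum_boole,
      Finset.sum_const, nsmul_eq_mul, hB]
    ring
  rw [← hsum]
  exact Finset.sum_le_sum hpt

/-! ### Glue 3 (PROVED): the advantage identity, as an upper bound -/

/-- **Advantage identity ⇒ correlation bound** (the card's lever, cleared of denominators). With `N = #F`,
`C = Σ c`, `CG = Σ c·g`, `G = Σ g ∈ [0, N]`, `T = Σ t`, `2C = T − N` (dictionary `t = 2c + 1`),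
`|CG/C − G/N| ≤ ε` (PRG_cubic) and `|T − 2N| ≤ εN` (window mean): the correlation `Σ (t − 2) g = 2CG − G` is
at most `(2ε + ε²)·N` — since `N(2CG − G) = 2(N·CG − C·G) + (2C − N)·G`. -/
theorem corr_upper_bound {N C CG G T ε : ℝ} (hN : 0 < N) (hC : 0 < C) (hε : 0 ≤ ε)
    (hPRG : |CG / C - G / N| ≤ ε) (hG0 : 0 ≤ G) (hG1 : G ≤ N)
    (hT : |T - 2 * N| ≤ ε * N) (hC2 : 2 * C = T - N) :
    2 * CG - G ≤ (2 * ε + ε ^ 2) * N := by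
  have hCN : 0 < C * N := mul_pos hC hN
  have h1 : CG * N - C * G ≤ ε * (C * N) := by
    rw [div_sub_div CG G hC.ne' hN.ne', abs_div, abs_of_pos hCN, div_le_iff₀ hCN] at hPRG
    exact (le_abs_self _).trans hPRG
  have h3 : T - 2 * N ≤ ε * N := (le_abs_self _).trans hT
  have h4 : N * (2 * CG - G) = 2 * (CG * N - C * G) + (2 * C - N) * G := by ring
  have h5 : (2 * C - N) * G ≤ ε * N * N := by
    have h2C : 2 * C - N ≤ ε * N := by linarith
    calc (2 * C - N) * G ≤ (ε * N) * G := mul_le_mul_of_nonneg_right h2C hG0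
      _ ≤ ε * N * N := mul_le_mul_of_nonneg_left hG1 (by positivity)
  have h6 : C * N ≤ (1 + ε) / 2 * N * N := by
    have hCle : C ≤ (1 + ε) / 2 * N := by linarith
    exact mul_le_mul_of_nonneg_right hCle hN.le
  have h6' : ε * (C * N) ≤ ε * ((1 + ε) / 2 * N * N) := mul_le_mul_of_nonneg_left h6 hε
  have h7 : N * (2 * CG - G) ≤ N * ((2 * ε + ε ^ 2) * N) := by
    rw [h4]
    nlinarith [h1, h5, h6']
  exact le_of_mul_le_mul_left h7 hN

/-- The final arithmetic: the lower bound `(1 − η/6)M − B − (η/6)N ≤ S` with `M ≥ (1/3 + η)N`, `B ≤ N/3`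
is incompatible with the upper bound `S ≤ (2(η/8) + (η/8)²)N` for `0 < η ≤ 1`, `N > 0`. -/
theorem final_contradiction {η N M B S : ℝ} (hη : 0 < η) (hη1 : η ≤ 1) (hN : 0 < N)
    (hM : (1 / 3 + η) * N ≤ M) (hB : B ≤ 1 / 3 * N)
    (hL : (1 - η / 6) * M - B - η / 6 * N ≤ S)
    (hU : S ≤ (2 * (η / 8) + (η / 8) ^ 2) * N) : False := by
  have h1 : (1 - η / 6) * ((1 / 3 + η) * N) ≤ (1 - η / 6) * M :=
    mul_le_mul_of_nonneg_left hM (by linarith)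
  have h2 : (1 - η / 6) * ((1 / 3 + η) * N) - 1 / 3 * N - η / 6 * N ≤ (2 * (η / 8) + (η / 8) ^ 2) * N := by
    linarith
  have h3 : ((1 - η / 6) * (1 / 3 + η) - 1 / 3 - η / 6 - (2 * (η / 8) + (η / 8) ^ 2)) * N ≤ 0 := by
    nlinarith
  have h4 : (1 - η / 6) * (1 / 3 + η) - 1 / 3 - η / 6 - (2 * (η / 8) + (η / 8) ^ 2) ≤ 0 := by
    by_contra hpos
    push Not at hpos
    have := mul_pos hpos hN
    linarith
  nlinarith [mul_le_mul_of_nonneg_left hη1 hη.le, hη]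

/-! ### Small facts about acceptance probabilities -/

theorem prAcc_nonneg {α β : Type} (A : RandAlg α β) (ea : α → List Bool) (x : α) (E : Set β) :
    0 ≤ A.pr ea x E :=
  ENNReal.toReal_nonneg

theorem prAcc_le_one {α β : Type} (A : RandAlg α β) (ea : α → List Bool) (x : α) (E : Set β) :
    A.pr ea x E ≤ 1 := by
  unfold RandAlg.pr
  have h : (A.outputPMF ea x).toOuterMeasure E ≤ (A.outputPMF ea x).toOuterMeasure Set.univ :=
    PMF.toOuterMeasure_mono _ (fun y _ => Set.mem_univ y)
  rw [(PMF.toOuterMeasure_apply_eq_one_iff _ _).2 (Set.subset_univ _)] at h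
  simpa using ENNReal.toReal_mono ENNReal.one_ne_top h

/-! ### The composition: the five stubs imply the crux, BY NAME -/

/-- **`AvgFaceBeyondPrior` from the four open stubs** (kernel-checked; no `sorry` outside the stubs; hypotheses =
the four open statements under their registered names `Registered.stub_*`, each definitionally its `stub_*` theorem,
cf. `*_holds` and the wiring `example` below; the fifth, `stub_paramAmplification`, is PROVED — p96229 — and used
inside).
Unfold the crux (the ROUTE decl); given a PPT `A` with bad mass `≤ 1/3` at every level (`bad_set_of_heur`), amplify
(`stub_paramAmplification`, error `η/6` on good inputs) to `A'` and read `g = Pr[A' = 1]` as a statistic. At a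
large level `n`: the density floor (`stub_dhMeanImaginary` → `windowMeanTwo_of_dh`, `stub_secondMomentBelow`, LP)
and `corr_lower_bound`
give `Σ (t−2) g ≥ ((7/9)η − η²/6)·N`, while `stub_prgCubic` for `A'` (ε = η/8), `stub_cubicDictionary` and the
window mean give `Σ (t−2) g ≤ (η/4 + η²/64)·N` (`corr_upper_bound`) — impossible for `0 < η ≤ 1`, `N > 0`. -/
theorem AvgFaceBeyondPrior_of (h₁ : Registered.stub_prgCubic) (h₂ : Registered.stub_cubicDictionary)
    (h₃ : Registered.stub_dhMeanImaginary) (h₄ : Registered.stub_secondMomentBelow) :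
    AvgFaceBeyondPrior := by
  have hprgH : PrgCubic := h₁
  have hdictH : CubicDictionary := h₂
  have hmeanH : WindowMeanTwo := windowMeanTwo_of_dh h₃
  have hsecH : SecondMomentBelow := h₄
  -- stub 5 is CLOSED (p96229): discharged inside the proof, no longer a hypothesis
  have hampH : ParamAmplification := paramAmplification_holds
  obtain ⟨η, hη, hη1, hdens⟩ := density_floor hmeanH (secondMomentBelowBlock_of hsecH)
  -- unfold the ROUTE decl: a putative Heur_{1/3} witness `A` with bad mass ≤ 1/3 at every level
  unfold AvgFaceBeyondPrior
  intro hmemQ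
  simp only [HeurDeltaBPP, Set.mem_setOf_eq] at hmemQ
  obtain ⟨A, hA, hgood⟩ := hmemQ
  -- amplify the putative Heur_{1/3} decider
  obtain ⟨A', hA', hamp⟩ := hampH A hA (η / 6) (by positivity)
  -- pseudorandomness for the amplified algorithm, and the window mean
  have hprg := hprgH A' hA' (η / 8) (by positivity)
  have hmean : ∀ᶠ n : ℕ in atTop,
      dist ((∑ d ∈ fundBlock n, (quadFieldThreeTorsion (-(d:ℤ)) : ℝ)) / ((fundBlock n).card : ℝ)) 2 < η / 8 :=
    Metric.tendsto_nhds.1 hmeanH _ (by positivity)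
  obtain ⟨n, ⟨⟨hd, hpW⟩, hm⟩⟩ := ((hdens.and hprg).and hmean).exists
  rw [Real.dist_eq] at hm
  -- transport the pseudorandomness bound from the window `𝒲ₙ` (importable spelling) to `fundBlock n`
  have hp : |(∑ d ∈ fundBlock n, (cubicFieldCountOfDisc (-(d:ℤ)) : ℝ) * A'.pr paramEnc (encodeNat d, n) {true})
        / (∑ d ∈ fundBlock n, (cubicFieldCountOfDisc (-(d:ℤ)) : ℝ))
      - (∑ d ∈ fundBlock n, A'.pr paramEnc (encodeNat d, n) {true}) / ((fundBlock n).card : ℝ)| ≤ η / 8 := by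
    rw [sum_window_eq n (fun D => (cubicFieldCountOfDisc D : ℝ) * A'.pr paramEnc (encodeNat D.natAbs, n) {true}),
      sum_window_eq n (fun D => (cubicFieldCountOfDisc D : ℝ)),
      sum_window_eq n (fun D => A'.pr paramEnc (encodeNat D.natAbs, n) {true}), card_window_eq] at hpW
    simpa only [Int.natAbs_neg, Int.natAbs_natCast] using hpW
  -- the block is nonempty (else the window mean would be 0, not within η/8 ≤ 1/8 of 2)
  have hne : (fundBlock n).Nonempty := by
    by_contra hemp
    rw [Finset.not_nonempty_iff_eq_empty] at hemp
    rw [hemp, Finset.sum_empty, zero_div, zero_sub, abs_neg, abs_two] at hm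
    linarith
  have hNpos : (0:ℝ) < ((fundBlock n).card : ℝ) := by exact_mod_cast hne.card_pos
  -- the window mean, cleared of denominators
  have hTlo : (2 - η / 8) * ((fundBlock n).card : ℝ) < ∑ d ∈ fundBlock n, (quadFieldThreeTorsion (-(d:ℤ)) : ℝ) :=
    (lt_div_iff₀ hNpos).1 (by have := (abs_lt.1 hm).1; linarith)
  have hThi : (∑ d ∈ fundBlock n, (quadFieldThreeTorsion (-(d:ℤ)) : ℝ)) < (2 + η / 8) * ((fundBlock n).card : ℝ) :=
    (div_lt_iff₀ hNpos).1 (by have := (abs_lt.1 hm).2; linarith)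
  have hTabs : |(∑ d ∈ fundBlock n, (quadFieldThreeTorsion (-(d:ℤ)) : ℝ)) - 2 * ((fundBlock n).card : ℝ)|
      ≤ η / 8 * ((fundBlock n).card : ℝ) :=
    abs_sub_le_iff.2 ⟨by linarith, by linarith⟩
  -- per-element facts on the block
  have hF : ∀ d ∈ fundBlock n,
      ((((-(d:ℤ)) % 4 = 1 ∧ Squarefree (-(d:ℤ)) ∧ (-(d:ℤ)) ≠ 1) ∨
        (4 ∣ (-(d:ℤ)) ∧ ((-(d:ℤ)) / 4 % 4 = 2 ∨ (-(d:ℤ)) / 4 % 4 = 3) ∧ Squarefree ((-(d:ℤ)) / 4)))) ∧ 0 < d := by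
    intro d hd
    rw [fundBlock, Finset.mem_filter, Finset.mem_Ico] at hd
    exact ⟨hd.2, lt_of_lt_of_le (Nat.two_pow_pos _) hd.1.1⟩
  have hmem : ∀ d ∈ fundBlock n, (encodeNat d ∈ iq3Lang ↔ 1 < quadFieldThreeTorsion (-(d:ℤ))) := by
    intro d hd
    obtain ⟨hf, hpos⟩ := hF d hd
    have hneg : (-(d:ℤ)) < 0 := by omega
    rw [encodeNat_mem_iq3Lang, ← three_dvd_classNumber_iff_one_lt_quadFieldThreeTorsion hf hneg]
    exact ⟨fun h => h.2, fun h => ⟨hf, h⟩⟩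
  have hdict : ∀ d ∈ fundBlock n,
      (quadFieldThreeTorsion (-(d:ℤ)) : ℝ) = 2 * (cubicFieldCountOfDisc (-(d:ℤ)) : ℝ) + 1 := by
    intro d hd
    obtain ⟨hf, hpos⟩ := hF d hd
    have hD : (-(d:ℤ)) ∈ negFundDiscrs (d + 1) := by
      rw [mem_negFundDiscrs]
      exact ⟨⟨by push_cast; omega, by omega⟩, hf⟩
    have := hdictH (d + 1) (-(d:ℤ)) hD
    exact_mod_cast this
  have ht1 : ∀ d ∈ fundBlock n, 1 ≤ quadFieldThreeTorsion (-(d:ℤ)) :=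
    fun d _ => quadFieldThreeTorsion_pos _
  have ht3 : ∀ d ∈ fundBlock n, 1 < quadFieldThreeTorsion (-(d:ℤ)) → 3 ≤ quadFieldThreeTorsion (-(d:ℤ)) := by
    intro d _ hlt
    obtain ⟨r, hr⟩ := exists_quadFieldThreeTorsion_eq_pow (-(d:ℤ))
    rw [hr] at hlt ⊢
    rcases r with _ | r
    · simp at hlt
    · calc (3:ℕ) = 3 ^ 1 := by norm_num
        _ ≤ 3 ^ (r + 1) := Nat.pow_le_pow_right (by norm_num) (by omega)
  -- the bad set of A at level n has at most a third of the block
  obtain ⟨B, hBcard, hBF, hBgood⟩ :=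
    bad_set_of_heur hgood n (fundBlock n) (by unfold fundBlock; congr 1) hne
  -- the amplified statistic on good inputs
  have hgoodM : ∀ d ∈ fundBlock n, d ∉ B → 1 < quadFieldThreeTorsion (-(d:ℤ)) →
      1 - η / 6 ≤ A'.pr paramEnc (encodeNat d, n) {true} := by
    intro d hd hdB hm1
    have hlt : A.pr paramEnc (encodeNat d, n) {b | b ≠ iq3Lang.boolIndicator (encodeNat d)} < 1 / 4 :=
      hBgood d hd hdB
    have hind : iq3Lang.boolIndicator (encodeNat d) = true :=
      (Set.mem_iff_boolIndicator (s := iq3Lang) (encodeNat d)).1 ((hmem d hd).2 hm1)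
    have hle := hamp (encodeNat d, n) (iq3Lang.boolIndicator (encodeNat d)) hlt
    rw [hind, RandAlg.pr_ne_eq_one_sub] at hle
    linarith
  have hgoodN : ∀ d ∈ fundBlock n, d ∉ B → ¬ 1 < quadFieldThreeTorsion (-(d:ℤ)) →
      A'.pr paramEnc (encodeNat d, n) {true} ≤ η / 6 := by
    intro d hd hdB hm1
    have hlt : A.pr paramEnc (encodeNat d, n) {b | b ≠ iq3Lang.boolIndicator (encodeNat d)} < 1 / 4 :=
      hBgood d hd hdB
    have hind : iq3Lang.boolIndicator (encodeNat d) = false :=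
      (Set.notMem_iff_boolIndicator (s := iq3Lang) (encodeNat d)).1 (fun h => hm1 ((hmem d hd).1 h))
    have hle := hamp (encodeNat d, n) (iq3Lang.boolIndicator (encodeNat d)) hlt
    have hset : {b : Bool | b ≠ false} = {true} := by
      ext b
      cases b <;> simp
    rw [hind, hset] at hle
    exact hle
  -- LOWER bound on the correlation of g = Pr[A' = 1] with t − 2
  have hL := corr_lower_bound (fundBlock n) B hBF (fun d : ℕ => quadFieldThreeTorsion (-(d:ℤ)))
    (fun d : ℕ => A'.pr paramEnc (encodeNat d, n) {true}) (η₁ := η / 6) (by positivity) ht1 ht3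
    (fun d _ => prAcc_nonneg _ _ _ _) (fun d _ => prAcc_le_one _ _ _ _) hgoodM hgoodN
  beta_reduce at hL
  -- UPPER bound: advantage identity (dictionary + PRG_cubic + window mean)
  have hG0 : 0 ≤ ∑ d ∈ fundBlock n, A'.pr paramEnc (encodeNat d, n) {true} :=
    Finset.sum_nonneg fun d _ => prAcc_nonneg _ _ _ _
  have hG1 : (∑ d ∈ fundBlock n, A'.pr paramEnc (encodeNat d, n) {true}) ≤ ((fundBlock n).card : ℝ) := by
    calc (∑ d ∈ fundBlock n, A'.pr paramEnc (encodeNat d, n) {true}) ≤ ∑ d ∈ fundBlock n, (1:ℝ) :=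
          Finset.sum_le_sum fun d _ => prAcc_le_one _ _ _ _
      _ = ((fundBlock n).card : ℝ) := by rw [Finset.sum_const, nsmul_eq_mul, mul_one]
  have hTC : 2 * (∑ d ∈ fundBlock n, (cubicFieldCountOfDisc (-(d:ℤ)) : ℝ))
      = (∑ d ∈ fundBlock n, (quadFieldThreeTorsion (-(d:ℤ)) : ℝ)) - ((fundBlock n).card : ℝ) := by
    rw [Finset.sum_congr rfl hdict, Finset.sum_add_distrib, Finset.sum_const, nsmul_eq_mul, mul_one,
      ← Finset.mul_sum]
    ring
  have hCpos : 0 < ∑ d ∈ fundBlock n, (cubicFieldCountOfDisc (-(d:ℤ)) : ℝ) := by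
    nlinarith [hTC, hTlo, hNpos, hη1]
  have hS2 : (∑ d ∈ fundBlock n, ((quadFieldThreeTorsion (-(d:ℤ)) : ℝ) - 2) * A'.pr paramEnc (encodeNat d, n) {true})
      = 2 * (∑ d ∈ fundBlock n, (cubicFieldCountOfDisc (-(d:ℤ)) : ℝ) * A'.pr paramEnc (encodeNat d, n) {true})
        - ∑ d ∈ fundBlock n, A'.pr paramEnc (encodeNat d, n) {true} := by
    have hpt : ∀ d ∈ fundBlock n,
        ((quadFieldThreeTorsion (-(d:ℤ)) : ℝ) - 2) * A'.pr paramEnc (encodeNat d, n) {true}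
          = 2 * ((cubicFieldCountOfDisc (-(d:ℤ)) : ℝ) * A'.pr paramEnc (encodeNat d, n) {true})
            - A'.pr paramEnc (encodeNat d, n) {true} := by
      intro d hd
      rw [hdict d hd]
      ring
    rw [Finset.sum_congr rfl hpt, Finset.sum_sub_distrib, ← Finset.mul_sum]
  have hU : (∑ d ∈ fundBlock n, ((quadFieldThreeTorsion (-(d:ℤ)) : ℝ) - 2) * A'.pr paramEnc (encodeNat d, n) {true})
      ≤ (2 * (η / 8) + (η / 8) ^ 2) * ((fundBlock n).card : ℝ) := by
    rw [hS2]
    exact corr_upper_bound hNpos hCpos (by positivity) hp hG0 hG1 hTabs hTC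
  exact final_contradiction hη hη1 hNpos hd hBcard hL hU

/-- Wiring check: the registered stubs feed `AvgFaceBeyondPrior_of` as stated. -/
example : AvgFaceBeyondPrior :=
  AvgFaceBeyondPrior_of stub_prgCubic stub_cubicDictionary stub_dhMeanImaginary stub_secondMomentBelow

end Summit.QuantumAdvantage.QuantumAdvantage.Cruxes.AvgFaceBeyondPrior.CubicDiscriminantPseudorandomness

end
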